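import Summits.ResolutionOfSingularities.ResolutionOfSingularities.Theorems.PurelyInseparableDim4ChartAtlasSNCGoodGlobal
import HarnessLib

/-!
# Purely inseparable four-folds `z^p + F(x₁, …, x₄)`: the second good case of the S3-N2 dichotomy — ONE old member sheared
# into the new centre and `{x_j = 0}` not an old member (chart level and on `W`; brick S3-N2, positive side; typ-2 g5)

[OURS · counted 0] (D-0157 DOOR 2; DR-157-C; desk WORD #115 (a)/(c), #131 (c)). The S3-N2 dichotomy: the escaping global centre
`Zc` is snc with the transformed boundary iff on every chart the bad set `B = {x_j·𝒪 if {x_j = 0} is an old member} ∪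
{(x_m + b_m x_j)·𝒪 : m old, m ∈ S ∩ S', b_m ≠ 0}` has at most one element (negatives p690374; positives p691155/p692862). The
good case `B ⊆ {x_j·𝒪}` is on `W` since p697935's file (`hasSNCWith_transform_boundary_globalCentre_of_good`). PROVED here (no
`sorry`, no new axiom) — the OTHER good case `B = {(x_m + b_m x_j)·𝒪}`:

* `hasSNCWith_𝓘Λ_of_forall_mem_shape_shear` — chart level, membership form: `m ∈ T`, `j ∉ T`, `b ≠ 0`; any list whose members are
  `⊤`, the sheared member `(x_m + b·x_j)·𝒪`, or `(xᵢ + βᵢ·x_j + cᵢ)·𝒪` with `i ∉ {j, m}` (`β = 0` on `Λ_T ∪ {j}`, `c 0 = 0`; far members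
  allowed) has snc with `𝓘Λ_T` (p692862's `hasSNCWith_shear_offShear_translatedHyperplanes_𝓘Λ` + p697351's far-member peeling);
* **`hasSNCWith_transform_boundary_globalCentre_of_good_shear`** — on `W`: old near boundary `E = [(xᵢ + cᵢ)·𝒪 : i ∈ ms]` with
  `j ∉ ms`, one index `m ∈ ms` exempt and GOODNESS elsewhere (`∀ i ∈ ms, i ∈ S → i ∈ S' → i ≠ j → i ≠ m → bᵢ = 0`): then
  `HasSNCWith ((⟨(z^p+F)·𝒪, E, p⟩.transform π 𝓘Λ_S).boundary) Zc` (if `b_m = 0` or `m ∉ S ∩ S'` this is the first good case).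

Together: `|B| ≤ 1 ⇒ Zc` is snc with the whole transformed boundary on `W` — the positive side of S3-N2 is COMPLETE at W-level for
near, distinct-index old boundaries. Nothing here is a statement about resolution of singularities in dimension ≥ 4 /
characteristic `p` (NOT proved anywhere in this programme). bears_on: LADDER-RESOLUTION:D157-DOOR2 (res-dim4-pi). Supports
stmt-ResolutionOfSingularities-16155 (helper).
-/

-- every declaration of this summit lives under `Summit.ResolutionOfSingularities.ResolutionOfSingularities`
-- (summit = problem), which the duplicate-namespace linter flags; house convention (cf. the Target file).
set_option linter.dupNamespace false

noncomputable section

open MvPolynomial Finset CategoryTheory AlgebraicGeometry Opposite TopologicalSpace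
open AlgebraicGeometry.Scheme.IdealSheafData (ofIdealTop vanishingIdeal)

namespace Summit.ResolutionOfSingularities.ResolutionOfSingularities.Theorems.PIDim4

open Literature.AlgebraicGeometry.Resolution
open Literature.AlgebraicGeometry.Resolution.Hauser2010
open Literature.AlgebraicGeometry.Resolution.AffinePointBlowup (P A γ coord Wtop ξ)
open Literature.Barriers.ResolutionOfSingularities

namespace ChartDictionary

section Chart

variable {K : Type} [Field K] {T : Finset (Fin 4)} {j m : Fin 4} {b : K} {β c : Fin (4 + 1) → K}

/-! ## §1 Chart level: one in-centre sheared member, far members, `⊤`, any order -/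

/-- The sheared member in front of far members in front of a far-free list (`j, m` not in the lists). -/
theorem hasSNCWith_shear_offShear_translatedHyperplanes_𝓘Λ_far_append (hmT : m ∈ T) (hjT : j ∉ T) (hb : b ≠ 0)
    (hβj : β j.succ = 0) (hβT : ∀ i ∈ insert (0 : Fin (4 + 1)) (Fin.succ '' (T : Set (Fin 4))), β i = 0) (hc0 : c 0 = 0)
    (lb l₀ : List (Fin (4 + 1))) (hjl₀ : j.succ ∉ l₀) (hmlb : m.succ ∉ lb) (hml₀ : m.succ ∉ l₀)
    (hlb : ∀ i ∈ lb, i ∈ insert (0 : Fin (4 + 1)) (Fin.succ '' (T : Set (Fin 4))) ∧ c i ≠ 0)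
    (hl₀ : ∀ i ∈ l₀, i ∈ insert (0 : Fin (4 + 1)) (Fin.succ '' (T : Set (Fin 4))) → c i = 0) :
    HasSNCWith (lb.map (fun i => ofIdealTop (Ideal.span {(γ 4 K).symm (X i + C (β i) * X j.succ + C (c i))})) ++
        (ofIdealTop (Ideal.span {(γ 4 K).symm (X m.succ + C b * X j.succ)}) ::
          l₀.map fun i => ofIdealTop (Ideal.span {(γ 4 K).symm (X i + C (β i) * X j.succ + C (c i))})))
      (AffineCoordBlowup.𝓘Λ 4 K (insert 0 (Fin.succ '' (T : Set (Fin 4))))) := by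
  classical
  set Λ : Set (Fin (4 + 1)) := insert 0 (Fin.succ '' (T : Set (Fin 4))) with hΛ
  have hmΛ : m.succ ∈ Λ := Set.mem_insert_of_mem _ ⟨m, Finset.mem_coe.mpr hmT, rfl⟩
  have hβm : β m.succ = 0 := hβT _ hmΛ
  -- the whole configuration is snc (auxiliary centre `V(z)`): present the sheared member as the `m`-th shape
  have hβ0 : ∀ i ∈ insert (0 : Fin (4 + 1)) (Fin.succ '' ((∅ : Finset (Fin 4)) : Set (Fin 4))),
      Function.update β m.succ b i = 0 := by
    intro i hi
    rw [Finset.coe_empty, Set.image_empty] at hi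
    rcases hi with hi | hi
    · rw [hi, Function.update_of_ne (Fin.succ_ne_zero m).symm]
      exact hβT 0 (Set.mem_insert _ _)
    · exact absurd hi (Set.notMem_empty _)
  have hc0' : ∀ i ∈ insert (0 : Fin (4 + 1)) (Fin.succ '' ((∅ : Finset (Fin 4)) : Set (Fin 4))),
      Function.update c m.succ 0 i = 0 := by
    intro i hi
    rw [Finset.coe_empty, Set.image_empty] at hi
    rcases hi with hi | hi
    · rw [hi, Function.update_of_ne (Fin.succ_ne_zero m).symm]; exact hc0
    · exact absurd hi (Set.notMem_empty _)
  have hβj' : Function.update β m.succ b j.succ = 0 := by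
    rw [Function.update_of_ne (fun e => hjT (by rw [Fin.succ_inj.mp e]; exact hmT)), hβj]
  have hall : HasSNC (((m.succ :: (lb ++ l₀)).map fun i =>
      ofIdealTop (Ideal.span {(γ 4 K).symm (X i + C (Function.update β m.succ b i) * X j.succ +
        C (Function.update c m.succ 0 i))}))) :=
    (hasSNCWith_offShear_translatedHyperplanes_𝓘Λ (K := K) (T := ∅) (j := j) hβj' hβ0 hc0' _).hasSNC
  have hall' : HasSNC (ofIdealTop (Ideal.span {(γ 4 K).symm (X m.succ + C b * X j.succ)}) ::
      (lb ++ l₀).map fun i => ofIdealTop (Ideal.span {(γ 4 K).symm (X i + C (β i) * X j.succ + C (c i))})) := by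
    rw [List.map_cons, Function.update_self, Function.update_self, C_0, add_zero] at hall
    convert hall using 2
    refine List.map_congr_left fun i hi => ?_
    have him : i ≠ m.succ := fun e => by
      rcases List.mem_append.mp hi with hi | hi
      · exact hmlb (e ▸ hi)
      · exact hml₀ (e ▸ hi)
    rw [Function.update_of_ne him, Function.update_of_ne him]
  -- base: the sheared member and the far-free members (p692862), constants zeroed on `Λ_T` without changing the members
  set c₀ : Fin (4 + 1) → K := fun i => if i ∈ Λ then 0 else c i with hc₀
  have hc₀T : ∀ i ∈ Λ, c₀ i = 0 := fun i hi => by rw [hc₀]; exact if_pos hi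
  have hbase : HasSNCWith (ofIdealTop (Ideal.span {(γ 4 K).symm (X m.succ + C b * X j.succ)}) ::
      l₀.map fun i => ofIdealTop (Ideal.span {(γ 4 K).symm (X i + C (β i) * X j.succ + C (c i))}))
      (AffineCoordBlowup.𝓘Λ 4 K Λ) := by
    have h := hasSNCWith_shear_offShear_translatedHyperplanes_𝓘Λ (K := K) (T := T) (j := j) (c := c₀) hmT hjT hb hβj hβT hc₀T
      l₀ hjl₀
    rw [← hΛ] at h
    have hl : (l₀.map fun i => ofIdealTop (Ideal.span {(γ 4 K).symm (X i + C (β i) * X j.succ + C (c i))})) =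
        l₀.map fun i => ofIdealTop (Ideal.span {(γ 4 K).symm (X i + C (β i) * X j.succ + C (c₀ i))}) := by
      refine List.map_congr_left fun i hi => ?_
      have hci : c i = c₀ i := by
        by_cases hiΛ : i ∈ Λ
        · rw [hl₀ i hi hiΛ, hc₀T i hiΛ]
        · rw [hc₀]
          dsimp only
          rw [if_neg hiΛ]
      rw [hci]
    rw [hl]
    exact h
  -- prepend the far members (disjoint from the centre); the whole list is snc by `hall'` up to membership
  refine hasSNCWith_append_of_forall_disjoint hbase (fun D hD => ?_) ?_
  · obtain ⟨i, hi, rfl⟩ := List.mem_map.mp hD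
    obtain ⟨hiΛ, hci⟩ := hlb i hi
    rw [hβT i hiΛ, C_0, zero_mul, add_zero, AffineCoordBlowup.support_𝓘Λ]
    exact disjoint_support_translate_CΛ' hiΛ hci
  · refine hasSNCWith_of_forall_mem hall' fun D hD => ?_
    rcases List.mem_append.mp hD with hD | hD
    · obtain ⟨i, hi, rfl⟩ := List.mem_map.mp hD
      exact List.mem_cons_of_mem _ (List.mem_map.mpr ⟨i, List.mem_append.mpr (Or.inl hi), rfl⟩)
    · rcases List.mem_cons.mp hD with rfl | hD
      · exact List.mem_cons_self
      · obtain ⟨i, hi, rfl⟩ := List.mem_map.mp hD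
        exact List.mem_cons_of_mem _ (List.mem_map.mpr ⟨i, List.mem_append.mpr (Or.inr hi), rfl⟩)

/-- **THE SECOND GOOD CHART (membership form): one in-centre sheared member, no `x_j·𝒪`.** `m ∈ T`, `j ∉ T`, `b ≠ 0`, `β_j = 0`,
`β = 0` on `Λ_T`, `c 0 = 0`; `E` any list whose members are `⊤`, `(x_m + b·x_j)·𝒪`, or `(xᵢ + βᵢ·x_j + cᵢ)·𝒪` with
`i ∉ {j, m}` (far members allowed). Then `HasSNCWith E 𝓘Λ_T`. -/
theorem hasSNCWith_𝓘Λ_of_forall_mem_shape_shear (hmT : m ∈ T) (hjT : j ∉ T) (hb : b ≠ 0) (hβj : β j.succ = 0)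
    (hβT : ∀ i ∈ insert (0 : Fin (4 + 1)) (Fin.succ '' (T : Set (Fin 4))), β i = 0) (hc0 : c 0 = 0)
    {E : List (Scheme.IdealSheafData (P 4 K))}
    (hE : ∀ D ∈ E, D = ⊤ ∨ D = ofIdealTop (Ideal.span {(γ 4 K).symm (X m.succ + C b * X j.succ)}) ∨
      ∃ i : Fin (4 + 1), i ≠ j.succ ∧ i ≠ m.succ ∧
        D = ofIdealTop (Ideal.span {(γ 4 K).symm (X i + C (β i) * X j.succ + C (c i))})) :
    HasSNCWith E (AffineCoordBlowup.𝓘Λ 4 K (insert 0 (Fin.succ '' (T : Set (Fin 4))))) := by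
  classical
  set Λ : Set (Fin (4 + 1)) := insert 0 (Fin.succ '' (T : Set (Fin 4))) with hΛ
  let far : Fin (4 + 1) → Prop := fun i => i ∈ Λ ∧ c i ≠ 0
  let l : List (Fin (4 + 1)) := (List.finRange (4 + 1)).filter fun i => i ≠ j.succ ∧ i ≠ m.succ
  have hl : ∀ i ∈ l, i ≠ j.succ ∧ i ≠ m.succ := fun i hi => by
    have h2 := (List.mem_filter.mp hi).2
    simp only [decide_eq_true_eq] at h2
    exact h2
  have h := hasSNCWith_shear_offShear_translatedHyperplanes_𝓘Λ_far_append (K := K) (T := T) hmT hjT hb hβj hβT hc0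
    (l.filter fun i => far i) (l.filter fun i => ¬ far i)
    (fun h' => (hl _ (List.mem_of_mem_filter h')).1 rfl)
    (fun h' => (hl _ (List.mem_of_mem_filter h')).2 rfl) (fun h' => (hl _ (List.mem_of_mem_filter h')).2 rfl)
    (fun i hi => by
      have h2 := (List.mem_filter.mp hi).2
      simp only [decide_eq_true_eq] at h2
      exact h2)
    (fun i hi hiΛ => by
      have h2 := (List.mem_filter.mp hi).2
      simp only [decide_eq_true_eq] at h2
      by_contra hci
      exact h2 ⟨hiΛ, hci⟩)
  rw [← hΛ] at h
  refine hasSNCWith_of_forall_mem (hasSNCWith_cons_top h) fun D hD => ?_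
  rcases hE D hD with rfl | rfl | ⟨i, hij, him, rfl⟩
  · exact List.mem_cons_self
  · exact List.mem_cons_of_mem _ (List.mem_append.mpr (Or.inr List.mem_cons_self))
  · have hil : i ∈ l := List.mem_filter.mpr ⟨List.mem_finRange i, by simp only [decide_eq_true_eq]; exact ⟨hij, him⟩⟩
    refine List.mem_cons_of_mem _ ?_
    by_cases hfi : far i
    · exact List.mem_append.mpr (Or.inl (List.mem_map.mpr
        ⟨i, List.mem_filter.mpr ⟨hil, by simp only [decide_eq_true_eq]; exact hfi⟩, rfl⟩))
    · exact List.mem_append.mpr (Or.inr (List.mem_cons_of_mem _ (List.mem_map.mpr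
        ⟨i, List.mem_filter.mpr ⟨hil, by simp only [decide_eq_true_eq]; exact hfi⟩, rfl⟩)))

end Chart

/-! ## §2 On `W` -/

variable {K : Type} [Field K] {p : ℕ} [hp : Fact p.Prime] [CharP K p]
  {S S' : Finset (Fin 4)} {j m : Fin 4} {b : Fin 4 → K} {Θⱼ : A 4 K ≃ₐ[K] A 4 K} {h : MvPolynomial (Fin 4) K}
  {F F₁ : MvPolynomial (Fin 4) K} {W : Scheme.{0}} {π : W ⟶ P 4 K}

/-- **THE SECOND GOOD CASE OF S3-N2 ON `W`.** As `hasSNCWith_transform_boundary_globalCentre_of_good`, but with ONE old index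
`m ∈ ms` exempt from goodness and `{x_j = 0}` NOT an old member (`j ∉ ms`): the escaping global centre `Zc` is snc with the whole
transformed boundary. -/
theorem hasSNCWith_transform_boundary_globalCentre_of_good_shear [IsAlgClosed K] (hj : j ∈ S) (hbj : b j = 0) (hF : F ≠ 0)
    (hclean : HauserPerlega.IsClean p F) (h0j : Θⱼ (X 0) = X 0 + rename Fin.succ h)
    (hsj : ∀ i : Fin 4, Θⱼ (X i.succ) = X i.succ + C (b i))
    (hπ : IsBlowup π (AffineCoordBlowup.𝓘Λ 4 K (insert 0 (Fin.succ '' (S : Set (Fin 4))))))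
    (hperm : (p : ℕ∞) ≤ CentreBlowup.ordAlong S F)
    (hread : Θⱼ (coordBlowupSubst K (insert 0 (Fin.succ '' (S : Set (Fin 4)))) j.succ (hyp p F)) = X j.succ ^ p * hyp p F₁)
    (hperm' : (p : ℕ∞) ≤ CentreBlowup.ordAlong S' F₁) (ms : List (Fin 4)) (hjms : j ∉ ms) (c : Fin 4 → K)
    (hc : ∀ i ∈ S, c i = 0) (hgood : ∀ i ∈ ms, i ∈ S → i ∈ S' → i ≠ j → i ≠ m → b i = 0) :
    haveI : IsIso (CommRingCat.ofHom (Θⱼ : A 4 K →+* A 4 K)) := (inferInstance : IsIso Θⱼ.toRingEquiv.toCommRingCatIso.hom)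
    HasSNCWith
      ((⟨hypSheaf p F, ms.map fun i => ofIdealTop (Ideal.span {(γ 4 K).symm (X i.succ + C (c i))}), p⟩ :
          MarkedIdeal (P 4 K)).transform π (AffineCoordBlowup.𝓘Λ 4 K (insert 0 (Fin.succ '' (S : Set (Fin 4)))))).boundary
      (vanishingIdeal (closureImage
        (Spec.map (CommRingCat.ofHom (Θⱼ : A 4 K →+* A 4 K)) ≫ AffineCoordBlowup.chartImm hπ (succ_mem_centreVars hj))
        ((AffineCoordBlowup.𝓘Λ 4 K (insert 0 (Fin.succ '' (S' : Set (Fin 4))))).support : Set (P 4 K)))) := by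
  classical
  -- if `m` is not an in-centre sheared index, this is the first good case
  by_cases hm : m ∈ ms ∧ m ∈ S ∧ m ∈ S' ∧ b m ≠ 0
  swap
  · refine hasSNCWith_transform_boundary_globalCentre_of_good hj hbj hF hclean h0j hsj hπ hperm hread hperm' ms c hc
      fun i hi hiS hiS' hij => ?_
    by_cases him : i = m
    · subst him
      by_contra hbi
      exact hm ⟨hi, hiS, hiS', hbi⟩
    · exact hgood i hi hiS hiS' hij him
  obtain ⟨hmms, hmS, hmS', hbm⟩ := hm
  have hmj : m ≠ j := fun e => hjms (e ▸ hmms)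
  haveI hisoj : IsIso (CommRingCat.ofHom (Θⱼ : A 4 K →+* A 4 K)) :=
    (inferInstance : IsIso Θⱼ.toRingEquiv.toCommRingCatIso.hom)
  haveI : IsProper π := hπ.isProper
  haveI : IsLocallyNoetherian W := LocallyOfFiniteType.isLocallyNoetherian π
  set Λ : Set (Fin (4 + 1)) := insert 0 (Fin.succ '' (S : Set (Fin 4))) with hΛ
  set φⱼ := Spec.map (CommRingCat.ofHom (Θⱼ : A 4 K →+* A 4 K)) ≫ AffineCoordBlowup.chartImm hπ (succ_mem_centreVars hj)
    with hφⱼ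
  set Zc := vanishingIdeal (closureImage φⱼ
    ((AffineCoordBlowup.𝓘Λ 4 K (insert 0 (Fin.succ '' (S' : Set (Fin 4))))).support : Set (P 4 K))) with hZc
  set E : List (Scheme.IdealSheafData (P 4 K)) := ms.map fun i => ofIdealTop (Ideal.span {(γ 4 K).symm (X i.succ + C (c i))})
    with hEdef
  -- (i) transformed boundary snc on `W`
  have hE : HasSNCWith E (AffineCoordBlowup.𝓘Λ 4 K Λ) := by
    let c5 : Fin (4 + 1) → K := Fin.cases 0 c
    have hc5 : ∀ i ∈ Λ, c5 i = 0 := by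
      rintro i (rfl | ⟨k, hk, rfl⟩)
      · rfl
      · exact hc k (Finset.mem_coe.mp hk)
    have h0 := hasSNCWith_translatedHyperplanes_𝓘Λ (K := K) (ms.map Fin.succ) c5 Λ hc5
    rw [List.map_map] at h0
    exact h0
  have hsncW : HasSNC (((⟨hypSheaf p F, E, p⟩ : MarkedIdeal (P 4 K)).transform π (AffineCoordBlowup.𝓘Λ 4 K Λ)).boundary) := by
    rw [MarkedIdeal.transform_boundary]
    exact hE.hasSNC_transform hπ
  -- (ii) cover
  have hcov : (Zc.support : Set W) ⊆ ⋃ (l : Fin 4) (hl : l ∈ S \ S'.erase j),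
      ((AffineCoordBlowup.chartImm hπ (succ_mem_centreVars (Finset.mem_sdiff.mp hl).1)).opensRange : Set W) := by
    by_cases hjS' : j ∈ S'
    · exact support_globalCentre_subset_iUnion_of_mem hj hjS' hbj h0j hsj hπ hperm hread hperm'
    · rw [Finset.erase_eq_of_notMem hjS']
      exact support_globalCentre_subset_iUnion hj hjS' hbj h0j hsj hπ hperm hread hperm'
  -- (iii) shear charts
  have hchart : ∀ l : {l : Fin 4 // l ∈ S \ S'.erase j}, l.1 ≠ j →
      ∃ (Θ : A 4 K ≃ₐ[K] A 4 K) (τ : MvPolynomial (Fin 4) K ≃ₐ[K] MvPolynomial (Fin 4) K)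
        (_ : IsIso (CommRingCat.ofHom (Θ : A 4 K →+* A 4 K))) (T : Finset (Fin 4)),
        (∀ i : Fin 4, Θ (X i.succ) = rename Fin.succ (τ (X i))) ∧ τ (X j) = X j ∧
        (∀ i ∈ S, i ≠ j → i ≠ l.1 → τ (X i) = X i + C (b i) * X j) ∧ (∀ k ∉ S, τ (X k) = X k + C (b k)) ∧
        j ∉ T ∧ (∀ i ∈ T, i ∈ S → i ≠ l.1 → i ∈ S') ∧ (∀ i ∈ S', i ≠ j → i ∈ T) ∧
        Zc.comap (Spec.map (CommRingCat.ofHom (Θ : A 4 K →+* A 4 K)) ≫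
            AffineCoordBlowup.chartImm hπ (succ_mem_centreVars (Finset.mem_sdiff.mp l.2).1)) =
          AffineCoordBlowup.𝓘Λ 4 K (insert 0 (Fin.succ '' (T : Set (Fin 4)))) ∧
        ((AffineCoordBlowup.𝓘Λ 4 K Λ).comap π).comap (Spec.map (CommRingCat.ofHom (Θ : A 4 K →+* A 4 K)) ≫
            AffineCoordBlowup.chartImm hπ (succ_mem_centreVars (Finset.mem_sdiff.mp l.2).1)) =
          ofIdealTop (Ideal.span {(γ 4 K).symm (X l.1.succ + C 0)}) := by
    intro l hlj
    obtain ⟨hlS, hlS'e⟩ := Finset.mem_sdiff.mp l.2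
    have hlS' : l.1 ∉ S' := fun h' => hlS'e (Finset.mem_erase.mpr ⟨hlj, h'⟩)
    by_cases hjS' : j ∈ S'
    · obtain ⟨Θ, τ, g, hiso, -, hτ, hτj, -, hτS, hτk, -, hZ, -, -, -, hE1⟩ :=
        exists_shear_chart_reading_of_mem hj hjS' hbj hF hclean h0j hsj hπ hperm hread hperm' hlS hlS'
      refine ⟨Θ, τ, hiso, insert l.1 (S'.erase j), hτ, hτj, hτS, hτk, ?_, ?_, ?_, hZ, hE1⟩
      · intro h'
        rcases Finset.mem_insert.mp h' with h' | h'
        · exact hlj h'.symm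
        · exact (Finset.notMem_erase j S') h'
      · intro i hi _ hil
        rcases Finset.mem_insert.mp hi with hi | hi
        · exact absurd hi hil
        · exact Finset.mem_of_mem_erase hi
      · exact fun i hi hij => Finset.mem_insert_of_mem (Finset.mem_erase.mpr ⟨hij, hi⟩)
    · obtain ⟨Θ, τ, g, hiso, -, hτ, hτj, -, hτS, hτk, -, hZ, -, -, -, hE1⟩ :=
        exists_shear_chart_reading hj hjS' hbj hF hclean h0j hsj hπ hperm hread hperm' hlS hlS' (Ne.symm hlj)
      exact ⟨Θ, τ, hiso, S', hτ, hτj, hτS, hτk, hjS', fun i hi _ _ => hi, fun i hi _ => hi, hZ, hE1⟩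
  choose Θf τf hisof Tf hτf hτjf hτSf hτkf hjTf hTf hS'Tf hZf hE1f using hchart
  let U : {l : Fin 4 // l ∈ S \ S'.erase j} → Scheme.{0} := fun _ => P 4 K
  let φ : ∀ l : {l : Fin 4 // l ∈ S \ S'.erase j}, U l ⟶ W := fun l =>
    if hlj : l.1 = j then φⱼ
    else Spec.map (CommRingCat.ofHom (Θf l hlj : A 4 K →+* A 4 K)) ≫
      AffineCoordBlowup.chartImm hπ (succ_mem_centreVars (Finset.mem_sdiff.mp l.2).1)
  haveI hφ : ∀ l, IsOpenImmersion (φ l) := fun l => by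
    by_cases hlj : l.1 = j
    · simp only [φ, dif_pos hlj, hφⱼ]
      infer_instance
    · simp only [φ, dif_neg hlj]
      haveI := hisof l hlj
      infer_instance
  refine hasSNCWith_of_cover_comap φ hsncW ?_ fun l => ?_
  · intro w hw
    obtain ⟨l, hl⟩ := Set.mem_iUnion.mp (hcov hw)
    obtain ⟨hl, hw'⟩ := Set.mem_iUnion.mp hl
    refine Set.mem_iUnion.mpr ⟨⟨l, hl⟩, ?_⟩
    by_cases hlj : l = j
    · subst hlj
      simp only [φ, dif_pos rfl, hφⱼ]
      rw [range_specMap_comp_chartImm]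
      exact hw'
    · simp only [φ, dif_neg hlj]
      rw [range_specMap_comp_chartImm]
      exact hw'
  · by_cases hlj : l.1 = j
    · -- the `x_j`-chart: all members translated (the sheared one reads `(x_m + b_m)·𝒪`, far)
      simp only [φ, dif_pos hlj]
      rw [hφⱼ, comap_globalCentre, MarkedIdeal.transform_boundary]
      refine hasSNCWith_𝓘Λ_of_forall_mem_shape (T := S') (j := j) (β := fun _ => (0 : K))
        (c := Fin.cases (0 : K) fun i => b i + c i) rfl (fun _ _ => rfl) rfl ?_
      exact forall_mem_boundary_readings_translate_chart hj ms c hc hsj _ (fun i _ => rfl) hπ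
    · -- a shear chart `x_l`: exactly one in-centre sheared member, `x_j·𝒪` absent
      simp only [φ, dif_neg hlj]
      rw [hZf l hlj, MarkedIdeal.transform_boundary]
      obtain ⟨hlS, -⟩ := Finset.mem_sdiff.mp l.2
      haveI := hisof l hlj
      have hml : m ≠ l.1 := fun e => by
        have := Finset.mem_sdiff.mp l.2
        exact this.2 (Finset.mem_erase.mpr ⟨e ▸ hmj, e ▸ hmS'⟩)
      let β : Fin (4 + 1) → K := Fin.cases 0 fun i => if i ∈ ms ∧ i ∈ S ∧ i ≠ j ∧ i ≠ l.1 ∧ i ≠ m then b i else 0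
      let c' : Fin (4 + 1) → K := Fin.cases 0 fun i => if i ∈ S then 0 else b i + c i
      have hβsucc : ∀ i : Fin 4, β i.succ = if i ∈ ms ∧ i ∈ S ∧ i ≠ j ∧ i ≠ l.1 ∧ i ≠ m then b i else 0 := fun i => rfl
      have hc'succ : ∀ i : Fin 4, c' i.succ = if i ∈ S then 0 else b i + c i := fun i => rfl
      refine hasSNCWith_𝓘Λ_of_forall_mem_shape_shear (T := Tf l hlj) (j := j) (m := m) (b := b m) (β := β) (c := c')
        (hS'Tf l hlj m hmS' hmj) (hjTf l hlj) hbm ?_ ?_ rfl ?_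
      · rw [hβsucc, if_neg (fun h' => h'.2.2.1 rfl)]
      · rintro i (rfl | ⟨k, hk, rfl⟩)
        · rfl
        · rw [hβsucc]
          by_cases hcond : k ∈ ms ∧ k ∈ S ∧ k ≠ j ∧ k ≠ l.1 ∧ k ≠ m
          · rw [if_pos hcond]
            exact hgood k hcond.1 hcond.2.1 (hTf l hlj k (Finset.mem_coe.mp hk) hcond.2.1 hcond.2.2.2.1) hcond.2.2.1
              hcond.2.2.2.2
          · rw [if_neg hcond]
      · -- the readings (p696282's dictionary member by member), `β` switched off at `m`; the member `m` separately
        intro D hD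
        rw [List.map_append, List.map_map, List.map_map, List.mem_append, List.mem_map, List.map_singleton,
          List.mem_singleton] at hD
        rcases hD with ⟨i, hi, rfl⟩ | rfl
        · by_cases him : i = m
          · right; left
            simp only [Function.comp_apply]
            rw [him, hc m hmS, C_0, add_zero, show (γ 4 K).symm (X m.succ) = coord 4 K m.succ from rfl]
            exact comap_shear_chart_strictTransform_hyperplane_shear hlS hml (hτf l hlj) (hτSf l hlj m hmS hmj hml) hπ
          · by_cases hil : i = l.1
            · left
              simp only [Function.comp_apply]
              rw [hil, hc l.1 hlS, C_0, add_zero, show (γ 4 K).symm (X l.1.succ) = coord 4 K l.1.succ from rfl]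
              exact comap_shear_chart_strictTransform_hyperplane_self hlS _ hπ
            · right; right
              refine ⟨i.succ, fun e => hjms ((Fin.succ_inj.mp e) ▸ hi), fun e => him (Fin.succ_inj.mp e), ?_⟩
              simp only [Function.comp_apply]
              by_cases hiS : i ∈ S
              · have hij : i ≠ j := fun e => hjms (e ▸ hi)
                rw [hc i hiS, C_0, add_zero, hc'succ, if_pos hiS, C_0, add_zero,
                  show (γ 4 K).symm (X i.succ) = coord 4 K i.succ from rfl, hβsucc, if_pos ⟨hi, hiS, hij, hil, him⟩]
                exact comap_shear_chart_strictTransform_hyperplane_shear hlS hil (hτf l hlj) (hτSf l hlj i hiS hij hil) hπ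
              · rw [hβsucc, if_neg (fun h' => hiS h'.2.1), C_0, zero_mul, add_zero, hc'succ, if_neg hiS]
                exact comap_shear_chart_strictTransform_translate hlS hiS (c i) (hτf l hlj) (hτkf l hlj i hiS) hπ
        · right; right
          refine ⟨l.1.succ, fun e => hlj (Fin.succ_inj.mp e), fun e => hml (Fin.succ_inj.mp e).symm, ?_⟩
          rw [hβsucc, if_neg (fun h' => h'.2.2.2.1 rfl), C_0, zero_mul, add_zero, hc'succ, if_pos hlS]
          exact hE1f l hlj

end ChartDictionary

end Summit.ResolutionOfSingularities.ResolutionOfSingularities.Theorems.PIDim4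

end
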